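import Literature.Topology.FourManifolds.SurfaceGroupNielsenCoreCasePJAux
import HarnessLib

/-!
# Nielsen's theorem, pillar CORE: a portal at `a`, a junction at `b`, partner outside

Topic `Literature/Topology/FourManifolds`.  The case P-J (β) of the case analysis of a double
point `a < b` on the closed path of a potential-minimal configuration (Zieschang–Vogt–Coldewey,
LNM 835, proof of Thm. 5.3.2 with Lemma 5.3.4, in the lead's minimal-counterexample recasting):
the cut `a` is interior to the kernel of the occurrence `k` (between its slots `sa - 1 | sa`,
`sa = slotAt k a`, value `V = fac k`, `n = |V|`), the cut `b = Kstart (k₃ + 1)` is a junction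
with spur `T_b = tail k₃` of length `c_b = jc k₃`, and the partner occurrence `k̄` lies OUTSIDE
(the mirror image of the case (α) of `SurfaceGroupNielsenCoreCasePJ.lean`).

* crossing edges of the fixation: the formal edges at the post-cut slots `(k, q)`,
  `sa ≤ q < n`, whose far end `(k̄, n - 1 - q)` is a head slot (interval lemma), of level
  `n - 1 - q ∈ [0, n - sa)`, and the spur edges `β_e`, `e < c_b`, of level `e` — nothing else;
* the parity principle level by level gives `c_b = n - sa` and pairs the two crossing edges of
  each level `e < n - sa` on one component, whose head slots `(k̄, e)`, `(k₃ + 1, e)` carry one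
  letter: `head (k₃ + 1) = (V[sa, n))⁻¹`, i.e. `T_b = V[sa, n)` (the post-cut part of `V`);
* vertices: the spur hangs at `absv b = absv a = E_k · V[0, sa)`, so its tip `E_{k₃+1}` is
  `E_k · V = E_{k+1}`, and the block of the inside occurrences `k + 1, …, k₃` (symbol-closed by
  Claim (A) — the symbol of `k` is not in it —, proper, and non-empty since `k₃ = k` would give
  `jc k = n - sa`, an empty post-cut kernel, against `a < Kend k`) has trivial value — a
  decomposition, contradicting indecomposability (`false_of_occStart_eq`).

## References

* H. Zieschang, E. Vogt, H.-D. Coldewey, *Surfaces and Planar Discontinuous Groups*, LNM 835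
  (1980), proof of Thm. 5.3.2 and Lemma 5.3.4. [ZieschangVogtColdewey1980]
-/

noncomputable section

namespace Literature.Topology.FourManifolds

open Literature.GroupTheory.CombinatorialGroupTheory CycFactors List

namespace SurfaceGroup

namespace Config

variable {g : ℕ} {φ : surfaceGen g → SurfaceGroup g}

section PJOut

variable (hg : 2 ≤ g) (hK : RelatorKilled φ) (hI : Indecomposable φ) (hM : MarkedNontrivial φ)
  (κ : Config φ) (hmin : κ.IsMin) (d : κ.DoublePoint)
include hg hK hI hM hmin

omit hK in
/-- **No double point with a portal at `a` and a junction at `b`, the partner of the portal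
occurrence lying outside.**  With `sa = slotAt k a`, `n = |V|` and the spur `T_b = tail k₃` of
the junction `b = Kstart (k₃ + 1)`: the crossing edges are the formal edges at `(k, q)`,
`sa ≤ q < n` (far end the head slot `(k̄, n - 1 - q)`, level `n - 1 - q ∈ [0, n - sa)`) and
the spur edges `β_e`, `e < c_b` (level `e`); the parity principle level by level gives
`c_b = n - sa` and pairs the two edges of each level, whence (head slots of one component carry
one letter) `head (k₃ + 1) = (V[sa, n))⁻¹`, `T_b = V[sa, n)`, so the tip `E_{k₃+1}` of the
spur is `E_{k+1}` and the block of the inside occurrences `k + 1, …, k₃` — symbol-closed by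
Claim (A), proper, and non-empty because `k₃ = k` would force `jc k = n - sa`, i.e. an empty
post-cut kernel — has trivial value, contradicting indecomposability.
[cite: ZieschangVogtColdewey1980, proof of Thm. 5.3.2 and Lemma 5.3.4] -/
theorem false_of_doublePoint_PJ_outside {k : ℕ} (hPa : κ.PortalAt d.a k) (hJb : κ.IsJunction d.b)
    (hout : κ.Outside d.a d.b (κ.bar k)) : False := by
  have hg1 : 1 ≤ g := by omega
  let _i : Inhabited (surfaceGen g) := ⟨(⟨0, by omega⟩, false)⟩
  have hN := κ.cycNielsen_U hg1 hI hM hmin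
  have hU := κ.U_ne_nil hg1
  have hbar := κ.isPairing_bar
  have hab := d.lt
  have hbℓ := d.lt_length
  have hk : k < κ.w.length := κ.lt_length_of_portalAt hPa (hab.trans hbℓ).le
  have hkU : k < κ.U.length := by rw [length_U]; exact hk
  have hbkU : κ.bar k < κ.U.length := hbar.lt k hkU
  have hbk : κ.bar k < κ.w.length := by rw [← length_U]; exact hbkU
  have hbb : κ.bar (κ.bar k) = k := hbar.bar_bar k hkU
  -- the junction `b = Kstart (k₃ + 1)`, `k ≤ k₃`
  obtain ⟨k₄, hk₄, hKb⟩ := id hJb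
  have hkk₄ : k < k₄ :=
    (κ.Kstart_lt_Kstart_iff hg1 hI hM hmin).1 (by rw [hKb]; exact hPa.1.trans hab)
  obtain ⟨k₃, rfl⟩ : ∃ k₃, k₄ = k₃ + 1 := ⟨k₄ - 1, by omega⟩
  have hk₃ : k₃ < κ.w.length := by omega
  -- numerical data of the portal occurrence `k` and of the spur
  obtain ⟨hc₁sa, hsac₂⟩ := κ.slotAt_bounds_of_portalAt hg1 hI hM hmin hPa
  set n := (fac κ.U k).length with hn
  have hnbar : (fac κ.U (κ.bar k)).length = n := hbar.length_fac_bar hkU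
  set sa := κ.slotAt k d.a with hsa
  set n₃ := (fac κ.U k₃).length with hn₃
  set cb := jc κ.U k₃ with hcb
  have hcbn₃ : cb ≤ n₃ := jc_le_length κ.U k₃
  have hcbn₄ : cb ≤ (fac κ.U (k₃ + 1)).length := jc_le_length_succ κ.U k₃
  -- separation, (P2), the interval lemma: the head of `k̄` has length `≥ n - sa`
  have hsep : ∀ j, ¬ (κ.PortalAt d.a j ∧ κ.PortalAt d.b j) := fun j h =>
    κ.not_portalAt_of_isJunction hJb j h.2
  have hJa : ¬ κ.IsJunction d.a := κ.not_isJunction_of_portalAt hPa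
  have hP2 := DoublePoint.kpos_mem_iff_of_chainEnd κ hg1 hI hM hmin d
  have hDj : n - sa ≤ jc κ.U (cpred κ.U (κ.bar k)) :=
    κ.sub_slotAt_le_jc_cpred_bar_of_portalAt_left_of_outside hg1 hI hM hmin hab hsep hP2 hk hPa hout
  have h2D : 2 * (n - sa) ≤ n := by
    have := (hN.pair (cpred κ.U (κ.bar k))).2
    rw [fac_cpred_succ, hnbar] at this
    omega
  -- the side function of the fixation
  obtain ⟨s, hs⟩ : ∃ s : ℕ × ℕ → Bool, ∀ σ, s σ = decide (κ.SideIn d.a d.b σ) := ⟨_, fun _ => rfl⟩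
  have hP2s : ∀ τ, IsKernelSlot κ.U τ → s τ = s (chainEnd κ.U κ.bar τ) := fun τ hτ => by
    rw [hs, hs]
    exact κ.decide_sideIn_eq_decide_sideIn_chainEnd hg1 hI hM hmin hab hsep hP2 hτ
  have hsf : ∀ σ, IsCrossing s (fedge κ.U κ.bar σ) ↔ κ.FCross d.a d.b σ := fun σ => by
    rw [isCrossing_fedge, hs, hs, κ.fcross_iff_decide_ne]
  have hsc : ∀ σ, IsSlot κ.U σ → ¬ IsKernelSlot κ.U σ →
      (IsCrossing s (cedge κ.U σ) ↔ κ.CCross d.a d.b σ) := fun σ h1 h2 => by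
    rw [isCrossing_cedge, hs, hs, κ.ccross_iff_decide_ne h1 h2]
  -- (1) the crossing edges: `fedge (k, q)`, `sa ≤ q < n` (level `n - 1 - q`), and the spur
  -- edges `cedge (k₃, n₃-1-e)`, `e < cb` (level `e`)
  have hXf : ∀ q, IsCrossing s (fedge κ.U κ.bar (k, q)) ↔ sa ≤ q := fun q => by
    rw [hsf]
    exact κ.fcross_iff_of_portalAt_left_of_outside hg1 hI hM hmin hab hsep hPa hout q
  have hXc : ∀ e, e < cb → IsCrossing s (cedge κ.U (k₃, n₃ - 1 - e)) := fun e he => by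
    have ht := κ.pj_isTailSlot_spur hk₃ he
    rw [hsc _ ht.1 (fun h => h.not_isTailSlot ht)]
    exact κ.pj_ccross_spur hg1 hI hM hmin hab hbℓ hsep hk₄ hKb he
  have hLf : ∀ q, sa ≤ q → q < n → ∀ ρ ∈ (fedge κ.U κ.bar (k, q)).2, level κ.U ρ = n - 1 - q :=
    fun q h1 h2 => κ.pj_level_fedge hk (by omega)
  have hLc : ∀ e, e < cb → ∀ ρ ∈ (cedge κ.U (k₃, n₃ - 1 - e)).2, level κ.U ρ = e := fun e he =>
    κ.pj_level_cedge hg1 hI hM hmin hk₃ he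
  -- the crossing edges all of whose ends have level `e₀`
  have hclass : ∀ ε', IsEdge κ.U κ.bar ε' → IsCrossing s ε' → ∀ e₀,
      (∀ ρ' ∈ ε'.2, level κ.U ρ' = e₀) →
      (e₀ < n - sa ∧ ε' = fedge κ.U κ.bar (k, n - 1 - e₀)) ∨
        (e₀ < cb ∧ ε' = cedge κ.U (k₃, n₃ - 1 - e₀)) := by
    intro ε' hε' hc' e₀ hlev
    obtain ⟨σ', hσ', h' | ⟨hkσ', h'⟩⟩ := hε'
    · subst h'
      obtain ⟨q, hqn, hcq, he⟩ :=
        κ.pj_fcross_classify hg1 hI hM hmin hP2 hk hPa hJb hσ' ((hsf σ').1 hc')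
      have hq : sa ≤ q :=
        (κ.fcross_iff_of_portalAt_left_of_outside hg1 hI hM hmin hab hsep hPa hout q).1 hcq
      have hl := hlev (k, q) (by rw [he]; exact mem_fedge.2 (Or.inl rfl))
      rw [hLf q hq hqn (k, q) (mem_fedge.2 (Or.inl rfl))] at hl
      refine Or.inl ⟨by omega, ?_⟩
      rw [he, show n - 1 - e₀ = q by omega]
    · subst h'
      obtain ⟨e, he, hle, hee⟩ := κ.pj_ccross_classify hg1 hI hM hmin hab hbℓ hsep hJa hk₄ hKb
        hσ' hkσ' ((hsc σ' hσ' hkσ').1 hc')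
      have hl := hlev σ' (mem_cedge.2 (Or.inl rfl))
      rw [hle] at hl
      subst hl
      exact Or.inr ⟨he, hee⟩
  -- (2) parity: `cb ≤ n - sa` (else `β_{n-sa}` is alone at its level) ...
  have hcb1 : cb ≤ n - sa := by
    by_contra hlt
    have hlt' : n - sa < cb := by omega
    have ht := κ.pj_isTailSlot_spur hk₃ hlt'
    refine false_of_crossing_alone_level hN hU hbar hP2s
      (isEdge_cedge ht.1 fun h => h.not_isTailSlot ht) (hXc _ hlt')
      ⟨(k₃, n₃ - 1 - (n - sa)), mem_cedge.2 (Or.inl rfl), hLc _ hlt' _ (mem_cedge.2 (Or.inl rfl))⟩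
      fun ε' hε' hc' hlev => ?_
    rcases hclass ε' hε' hc' (n - sa) hlev with ⟨h1, -⟩ | ⟨-, h2⟩
    · exact absurd h1 (lt_irrefl _)
    · exact h2
  -- ... and `n - sa ≤ cb` (else the formal edge at `(k, n - 1 - cb)`, of level `cb`, is alone)
  have hcb2 : n - sa ≤ cb := by
    by_contra hlt
    have hlt' : cb < n - sa := by omega
    have hσ : IsSlot κ.U (k, n - 1 - cb) := ⟨hkU, by dsimp only; omega⟩
    refine false_of_crossing_alone_level hN hU hbar hP2s (e := cb) (isEdge_fedge hσ)
      ((hXf (n - 1 - cb)).2 (by omega))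
      ⟨(k, n - 1 - cb), mem_fedge.2 (Or.inl rfl), by
        rw [hLf (n - 1 - cb) (by omega) (by omega) _ (mem_fedge.2 (Or.inl rfl))]; omega⟩
      fun ε' hε' hc' hlev => ?_
    rcases hclass ε' hε' hc' cb hlev with ⟨-, h1⟩ | ⟨h2, -⟩
    · exact h1
    · exact absurd h2 (lt_irrefl _)
  have hcbD : cb = n - sa := le_antisymm hcb1 hcb2
  -- non-emptiness of the inside block: `k < k₃` (else `jc k = n - sa`, an empty post-cut kernel)
  have hkk₃ : k < k₃ := by
    by_contra h
    have e : k₃ = k := by omega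
    have : cb = jc κ.U k := by rw [hcb, e]
    omega
  -- (3) pairs: for `e < n - sa` the head slots `(k̄, e)` and `(k₃ + 1, e)` share a component,
  -- hence a letter: `(fac (k₃+1))[e] = (V[n-1-e])⁻¹`
  have hletter : ∀ e, e < n - sa →
      (fac κ.U (k₃ + 1))[e]? = ((fac κ.U k)[n - 1 - e]?).map fun z => (z.1, !z.2) := by
    intro e he
    have hecb : e < cb := by omega
    have hσ : IsSlot κ.U (k, n - 1 - e) := ⟨hkU, by dsimp only; omega⟩
    have hfp : fpartner κ.U κ.bar (k, n - 1 - e) = (κ.bar k, e) :=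
      Prod.ext rfl (by dsimp only [fpartner]; omega)
    have hh1 : IsHeadSlot κ.U (κ.bar k, e) := by
      have := κ.isHeadSlot_of_portalAt_left_of_outside hg1 hI hM hmin hab hsep hP2 hk hPa hout
        (q := n - 1 - e) (by omega) (by omega)
      rwa [show n - 1 - (n - 1 - e) = e by omega] at this
    have ht2 : IsTailSlot κ.U (k₃, n₃ - 1 - e) := κ.pj_isTailSlot_spur hk₃ hecb
    have hcg : cget κ.U (k₃, n₃ - 1 - e) = (k₃ + 1, e) := κ.pj_cget_spur hk₄ hecb
    have hh2 : IsHeadSlot κ.U (k₃ + 1, e) := hcg ▸ ht2.isHeadSlot_cget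
    have hsc' := sameComp_of_crossing_pair_level hN hU hbar hP2s (e := e)
      (ε₂ := cedge κ.U (k₃, n₃ - 1 - e)) (isEdge_fedge hσ) ((hXf (n - 1 - e)).2 (by omega))
      ⟨(k, n - 1 - e), mem_fedge.2 (Or.inl rfl), by
        rw [hLf (n - 1 - e) (by omega) (by omega) _ (mem_fedge.2 (Or.inl rfl))]; omega⟩
      (fun ε' hε' hc' hlev => by
        rcases hclass ε' hε' hc' e hlev with ⟨-, h⟩ | ⟨-, h⟩
        · exact Or.inl h
        · exact Or.inr h)
      (κ.bar k, e) (mem_fedge.2 (Or.inr hfp.symm)) (k₃ + 1, e)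
      (mem_cedge.2 (Or.inr hcg.symm))
    have hL := hsc'.slotLetter_eq_of_slotType_eq hN hU hbar
      (by rw [hh2.slotType_eq hN hU, hh1.slotType_eq hN hU])
    have hfp' : slotLetter κ.U (κ.bar k, e) =
        ((slotLetter κ.U (k, n - 1 - e)).1, !(slotLetter κ.U (k, n - 1 - e)).2) := by
      rw [← hfp]
      exact hbar.slotLetter_fpartner hσ
    have e1 : (fac κ.U (k₃ + 1))[e]? = some (slotLetter κ.U (k₃ + 1, e)) := hh2.1.getElem?_eq
    have e2 : (fac κ.U k)[n - 1 - e]? = some (slotLetter κ.U (k, n - 1 - e)) := hσ.getElem?_eq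
    rw [e1, e2, hL, hfp', Option.map_some]
  -- the head of `k₃ + 1` is the inverse of the post-cut part of `V`; the spur word is that part
  have hH : CycFactors.head κ.U (k₃ + 1) = FreeGroup.invRev ((fac κ.U k).drop sa) := by
    rw [CycFactors.head, jc_cpred_succ]
    exact pj_take_eq_invRev_drop (by omega) hcbn₄ fun e he => hletter e (by omega)
  have hT : CycFactors.tail κ.U k₃ = (fac κ.U k).drop sa := by
    rw [tail_eq_invRev_head_succ, hH, FreeGroup.invRev_invRev]
  -- (4) vertices: the spur tip `E_{k₃+1}` is `E_{k+1}`
  have hva : κ.absv d.a = κ.occStart k * proj g (FreeGroup.mk ((fac κ.U k).take sa)) := by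
    have e : kpos κ.U (k, sa) = d.a := κ.kpos_slotAt hPa.1.le
    rw [← e]
    exact κ.absv_kpos hN hk (by omega) (by omega)
  have hvab : κ.absv d.a = κ.absv d.b := (κ.absv_eq_absv_iff _ _).2 d.pv_eq
  have hocc : κ.occStart (k₃ + 1) = κ.occStart (k + 1) := by
    rw [κ.occStart_succ_eq_absv_mul_tail hN hk₃, hKb, ← hvab, hva, hT, mul_assoc, ← map_mul,
      FreeGroup.mul_mk, List.take_append_drop, κ.occStart_mul_proj_fac hk]
  -- (5) the block `k + 1, …, k₃` of the inside occurrences is symbol-closed, non-empty, proper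
  have hinside := κ.pj_inside_iff hg1 hI hM hmin hPa hKb
  refine false_of_occStart_eq hI κ (j₁ := k + 1) (j₂ := k₃ + 1) (by omega) (by omega) (by omega)
    (κ.blockClosed_of_bar fun j hj h1 h2 => ?_) hocc.symm
  have hjU : j < κ.U.length := by rw [length_U]; exact hj
  have hjin : κ.Inside d.a d.b j := (hinside j).2 ⟨by omega, h2⟩
  have hna : ¬ κ.PortalAt d.a j := fun h => by
    have := κ.portalAt_unique h hPa
    omega
  have hna' : ¬ κ.PortalAt d.a (κ.bar j) := fun h => by
    have e : κ.bar j = k := κ.portalAt_unique h hPa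
    have e' : j = κ.bar k := by rw [← hbar.bar_bar j hjU, e]
    rw [e'] at hjin
    exact κ.not_outside_of_inside hg1 hI hM hmin hjin hout
  have hbin := (κ.inside_iff_inside_bar hg1 hI hM hmin hP2 hj hna
    (κ.not_portalAt_of_isJunction hJb j) hna' (κ.not_portalAt_of_isJunction hJb _)).1 hjin
  have := (hinside _).1 hbin
  exact ⟨by omega, by omega⟩

end PJOut

end Config

end SurfaceGroup

end Literature.Topology.FourManifolds

end
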